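import Summits.QuantumFields.BalabanUV.T4Continuum.Support.NE9CurChartTowerPiLatticeUniformClassW80VJ
import Summits.QuantumFields.BalabanUV.T4Continuum.Support.NE9CurChartTowerPiLatticeUniformClassW80Delta

/-!
# NE9CurChartTowerPiLatticeUniformClassW80VJDelta — THE LATTICE-UNIFORM `cur U` CHART ON PRINT's SMALL-FIELD CLASS WITH THE CONCRETE (L3) CURRENT `W80`
# READ AT THE CELL's OWN LETTERS `ρ := rieszτ φ`, `τ`, `J := Jcur U`, `(C_V, R_V)`, AND THE CONCRETE `Δ_π := currentCLM φ lev₁ (∇^η_U) (Δ̃_{a,k} − Q_k†aQ_k)`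
# — NO DISPLAYED W-LETTER AT ALL; cell `pub-balaban`, T4-DAG §2 node U3 ∕ §6 NE9, WALL-NE9-P1 §3 (ii)∕(vii); NE9 crux-team (2) leaf prover 01
# (`b2b-balaban-t4-ne9-formalise-leaf-01`, gen 98); Summits-side sibling of (I-7-W80VJ) `Support/NE9CurChartTowerPiLatticeUniformClassW80VJ` under this seat's
# INTERFACE REQUEST NE9 [NE9LEAF01-G98-IFR] (HOME/INBOX.md; ruling e34b3e0c (0)); nothing printed asserted

HONEST FRAMING (T4-DAG PAGE 1).  Rung (B)+1 of the FINITE-VOLUME T⁴ programme — NOT infinite volume, NOT a mass gap, NOT the Clay problem.  NE9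
(`T4OutputRate.NE9` ∧ `FadingMemory`) is a cell NEW ESTIMATE, NOT PRINTED in [I] = [Balaban1987RG1] (CMP **109**) ∕ [II] = [Balaban1988RG2Cluster]
(CMP **116**), NOT PROVED here («NE9 ⇐ the named binders»; spine PROVED 0∕9).  HONEST DEPENDENCY (cell line, verbatim): continuum YM on T⁴ ⇐
BetaPertH ∧ nine spine estimates (0/9 proved); BetaPertH ⇐ (D1) ∧ (D4) ∧ CAP+tail; G-an2-4 gates asym, D1 and NE2/3/4.

WHAT THIS FILE PROVES (ONE theorem; 0 def, 0 sorry, axioms standard; composition BY NAME).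
**`cur_chart_exists_tower_pi_of_unitary_class_lattice_uniform_W80VJDelta`** — (I-7-W80VJ) VERBATIM with the call to (I-7-W80) replaced by
`NE9CurChartTowerPiLatticeUniformClassW80Delta.cur_chart_exists_tower_pi_of_unitary_class_lattice_uniform_W80Delta`: `∃ α₁ j₁ ε₄ ε_C R_b R′` BEFORE
`∀ n η m U …`; `∃ h52 hpos′ hposπ` PRODUCED; (Ψ1)–(Ψ3) of the chart of print's operator (3.122) at the geometric per-level profile with the (L3) slot
`W80 (rieszτ φ) τ U H̃_{1,k} C_k ε_C (Jcur U) (currentCLM φ lev₁ (∇^η_U) (Δ̃_{a,k} − Q_k†∘(aQ_k)))` — EVERY W-letter of (W-ii) discharged at the cell's letters: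
`ρ` (`‖rieszτ φ‖ ≤ M_φ²`), the contractive trace (`C_τ ≤ 1`), `J` (`‖Jcur U‖ ≤ ω³`, `B11Eq28JcurWindow`), `(C_V, R_V) = (C_V(d, M_φ, α₀, ω, Ω), 1/16)`
(`B11Eq98V0LettersLatticeUniform`), and `Δ_π` = print's `Δ_π + DRD*` of [Balaban1985Variational] (87)–(88) read as currents (lattice-free through the composite
letters of this lineage's `B11Ineq98W80CompositeLatticeFree`).  REMAINING DISPLAYED: the (115) profile bounds `ω, Ω` (incl. `w̲₁,₂⁻¹ ≤ Ω`), (I-7)'s model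
block — and NOTHING of the W-slot.
DISGUISE TEST: composition of landed theorems and two norm computations; no inequality of the series proved; NOT the two-background chart, NOT claimed
that Bałaban's 𝐇_k ∕ old terms meet these letters (O-NE9-1; #5 UNRULED); not NE9.
References (TYPES ∕ loci only): [Balaban1985BackgroundPropagators] (3.35)–(3.37) p. 396, (3.119) p. 419, (3.122) p. 420, Thm 3.12 p. 423, Thm 3.13 p. 426;
[Balaban1985Variational] (27)–(28) p. 282, (80) p. 290, (84)–(96) pp. 290–292, Prop. 4 (97)–(98) p. 293, (103) p. 293, Prop. 6 (117)–(121) p. 295;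
[Balaban1985Averaging] (18) p. 21, Prop. 2 p. 26.
-/

noncomputable section

open Metric Set

namespace Summit.QuantumFields.BalabanUV.T4Continuum.NE9CurChartTowerPiLatticeUniformClassW80VJDelta

open scoped InnerProductSpace ComplexConjugate BigOperators
open Literature.MathematicalPhysics.QuantumFieldTheory.Balaban1983to89
open B11Eq103H1Complex B11Eq115Space B11Eq174Chart
open B11Eq111FrakG (nabla115)
open B13Contraction113 (QuadAnalytic)
open B9SectCLatticeCarrier (Bond bpos btgt unshift)
open B4Sect5Torus (TSite)
open B7Prop1Explicit (U1 Wcx boxVec)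
open B7Prop2Explicit (pdev AvgClosed C0 c2' unitaryUnits avgClosed_unitaryUnits unitaryUnits_le_U1)
open B7Prop3Flat (c3)
open B9Eq315QTorus (perCfg cornerSite)
open B9Eq315QTower (towerP UlevOf)
open B9Eq326OperatorTower (QkW QkW_surjective laplaceAk)
open B9Eq310HessianOperator (adTransportW)
open B9Eq310DeltaPrime (plaqHolU)
open B9Eq324DeltaPrimeATower (laplacePrimeAk)
open B9Eq3119DeltaPiTower (laplaceAkPi)
open B11Eq44COperatorTower (αT αT_le ulev_mem_U1_of_pdev)
open B11Eq44COperatorTowerGeometric (ulev_reg_of_pdev_geometric geomProfile_nonneg geomProfile_le_αT sum_geomProfile_le)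
open B11Eq44CLetterTower (Cck)
open B9Thm311SmallFieldClosed (hRS_of_unitary)
open B9Eq315QTorusOnto (liftSite perSite_liftSite)
open B7Eq43AveragedSmallnessLevelFree (pdev_perCfg_le_of_plaq)
open B7Eq43AveragedSmallnessLinearFeed (twoWindows_linear_feed)
open B9Thm311SitePrimeFormCoerciveTowerCanonical (exists_strong_site_coercive_tower_diagonal)
open B9Thm311LaplaceAkPiPositiveDiagonal (exists_laplaceAkPi_pos_diagonal_closed)
open B9Thm311LaplaceAkPositiveDiagonal (exists_laplaceAk_pos_diagonal_closed)
open B9Eq326OperatorTowerRealityUnitary (UlevOf_star_eq_inv forall_star_eq_inv_of_mem)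
open B9Eq342GreenPrimeSupBound (norm_adTransportW_eq)
open Summit.QuantumFields.BalabanUV.T4Continuum.NE9CurChartTowerPiLatticeUniformClassW80Delta
  (cur_chart_exists_tower_pi_of_unitary_class_lattice_uniform_W80Delta)
open B9Eq3119DeltaPiCarrier (currentCLM)
open B11Eq98V0primeCurrentSlots (rieszτ rieszτ_apply)
open B11Eq98CurrentSlot (Jcur)
open B11Eq28JcurWindow (norm_Jcur_le_of_window levWeight_three_le)
open B11Eq98V0LettersLatticeUniform (curV0_quadBound_lattice_uniform)
open B11Eq80Current (W80)
open B11Eq63V0GroupCurrent (curV0)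

variable {d : ℕ} (hd : 1 ≤ d) (L : ℕ) [NeZero L] (hL : 1 ≤ L) (hL2 : 2 ≤ L) (hL3 : 3 ≤ L) [Fact (0 < (L : ℝ))]
  {𝔸 : Type*} [CStarAlgebra 𝔸] [Nontrivial 𝔸] [FiniteDimensional ℂ 𝔸]
  {W : Type*} [NormedAddCommGroup W] [InnerProductSpace ℂ W] [FiniteDimensional ℂ W] (φ : W ≃ₗ[ℂ] 𝔸)
  {Mφ Mφ' : ℝ} (hMφ : 0 ≤ Mφ) (hMφ' : 0 ≤ Mφ') (hφ : ∀ w, ‖φ w‖ ≤ Mφ * ‖w‖) (hφ' : ∀ X, ‖φ.symm X‖ ≤ Mφ' * ‖X‖)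
  {a : ℝ} (ha : 0 < a) {a' : ℝ} (ha' : 0 < a')
  (τ : 𝔸 →ₗ[ℂ] ℂ) {Cτ : ℝ} (hτ : ∀ X, ‖τ X‖ ≤ Cτ * ‖X‖) (hCτ : 0 ≤ Cτ) {Mτ : ℝ} (hτm : ∀ X Y : 𝔸, ‖τ (X * Y)‖ ≤ Mτ * ‖X‖ * ‖Y‖) (hMτ : 0 ≤ Mτ)
  {ρw : ℝ} (hρw : 0 ≤ ρw)
  (hτ₁ : ∀ X : 𝔸, τ (star X) = conj (τ X)) (hτ₂ : ∀ X Y : 𝔸, τ (X * Y) = τ (Y * X)) (hφτ : ∀ X Y : 𝔸, ⟪φ.symm X, φ.symm Y⟫_ℂ = τ (star X * Y))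
  {α₀ : ℝ} (hα₀ : 0 < α₀) (hα3 : C0 d * α₀ ≤ 1 / 3) (hα4 : 4 * α₀ ≤ c2' d L)
  (hαL : 50 * (d + 1) * αT d L α₀ * (L : ℝ) ^ d ≤ 1 / 2)
  {ρ : ℝ} (hρ0 : 0 < ρ) (hρ : Real.exp (4 * (800 * ((d : ℝ) + 1) ^ 2 * ((d : ℝ) + 4)) * α₀) * (1 + 8 * (131072 * ((d : ℝ) + 1) ^ 2) * ρ) ≤ 2)
  (hρ4 : 4 * ρ ≤ c3 d L) (hθ : 2 * d * B7Prop5GeneralLevels.thetaGen d L α₀ ≤ (L : ℝ) ^ 3 / 16) (hC3 : 2 * d * B7Prop5GeneralLevels.C3Gen d L * ρ ≤ 1)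
  (hCτ1 : Cτ ≤ 1) {ω Ω : ℝ} (hω1 : 1 ≤ ω) (hΩ1 : 1 ≤ Ω)

-- deep definitional unfolding `laplaceAkPi` ↦ `laplaceALatticeK … (π†Δπ) …` in the statement (as the host)
set_option maxRecDepth 8192 in
set_option maxHeartbeats 3200000 in -- (I-7-W80Δ)'s ≈ 60-binder theorem applied once + the letters
include hd hL2 hL3 hMφ hMφ' hφ hφ' ha ha' hτ hCτ hτm hMτ hρw hτ₁ hτ₂ hφτ hα₀ hα3 hα4 hαL hρ0 hρ hρ4 hθ hC3 hCτ1 hω1 hΩ1 in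
/-- **THE LATTICE-UNIFORM `cur U` CHART ON PRINT's CLASS WITH THE CONCRETE `W80` AT THE CELL's LETTERS `ρ = rieszτ φ`, `τ`, `J = Jcur U`, `(C_V, R_V)`
AND THE CONCRETE `Δ_π = currentCLM φ lev₁ (∇^η_U) (Δ̃_{a,k} − Q_k†aQ_k)` — NO W-LETTER DISPLAYED**: (I-7-W80VJ) with its last displayed pair `(Δ_π, M_Δ)`
DISCHARGED through (I-7-W80Δ) (`‖rieszτ φ‖ ≤ M_φ²`; contractive trace `C_τ ≤ 1`; `C_V` of `B11Eq98V0LettersLatticeUniform` at `α ≤ α₀`, `R_V = 1/16`;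
`‖Jcur U‖ ≤ ω³`); displayed: the profile bounds (incl. `w̲₁,₂⁻¹ ≤ Ω`) and (I-7)'s model block only. [folklore]
[cite: Balaban1985BackgroundPropagators, (3.119) p.419, (3.122) p.420, (3.35)–(3.37) p.396, Thm 3.12 p.423, Thm 3.13 p.426; Balaban1985Variational, (27)–(28) p.282, (80) p.290, (87)–(88) p.291, Prop. 4 (97)–(98) p.293, (103) p.293, Prop. 6 (117)–(121) p.295; Balaban1985Averaging, (18) p.21, Prop. 2 p.26] -/
theorem cur_chart_exists_tower_pi_of_unitary_class_lattice_uniform_W80VJDelta :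
    ∃ α₁ j₁ ε₄ εC Rb R' : ℝ, 0 < α₁ ∧ 0 < j₁ ∧ 0 < Rb ∧ 0 < R' ∧
      ∀ (n : ℕ) (η : ℝ) [Fact (0 < η)] (hηL : η * (L : ℝ) ^ (n + 1) = 1) (c₀ c₁ : ℝ) [Fact (0 < c₀)] [Fact (0 < c₁)]
        (_hw : c₀ * ((L : ℝ) ^ (n + 1)) ^ d = c₁) (_hc₀η : c₀ = η ^ d) (_hρ : |η| ^ d / c₀ ≤ ρw) (m : Fin d → ℕ) [∀ i, NeZero (m i)] (_hm : ∀ i, 1 ≤ m i)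
        (U : Bond d (towerP L m (n + 1)) → 𝔸ˣ) (hUG : ∀ (x : B7Prop1Explicit.Site d) (κ : Fin d), perCfg (towerP L m (n + 1)) U x κ ∈ unitaryUnits 𝔸)
        (α : ℝ) (_hα : 0 ≤ α) (_hαle : α ≤ α₁) (_hUη : ∀ b, ‖(U b : 𝔸) - 1‖ ≤ α * η)
        (_hpl : ∀ p : B9SectCLatticeCarrier.Plaq d (towerP L m (n + 1)), ‖(plaqHolU U p : 𝔸) - 1‖ ≤ α * η ^ 2)
        (_hUgrad : ∀ (x : TSite d (towerP L m (n + 1))) (μ : Fin d), ‖(U (x, μ) : 𝔸) - U (unshift μ x, μ)‖ ≤ α * η ^ 2)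
        (j₀ : ℝ) (_hJ : ∀ μ y, ‖B9Eq39Adjoint.J (fun μ => B9Eq33CovDerivVector.shiftEquiv μ) (fun μ y => U (y, μ)) η μ y‖ ≤ j₀) (_hj : j₀ ≤ j₁)
        (lev₀ : Bond d (towerP L m (n + 1)) → ℕ) (lev₁ : Bond d (towerP L m (n + 1)) × Fin d → ℕ) (levB : Bond d m → ℕ) (_hlev : ∀ b, n + 1 ≤ lev₀ b)
        (_hw₀ : (NegSup.wSup (levWeight (L : ℝ) η lev₀ 1) : ℝ) ≤ ω) (_hw₁ : (NegSup.wSup (levWeight (L : ℝ) η lev₁ 2) : ℝ) ≤ ω)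
        (_hw₃ : (NegSup.wInvSup (levWeight (L : ℝ) η lev₀ 3) : ℝ) ≤ Ω) (_hwB : (NegSup.wInvSup (levWeight (L : ℝ) η levB 0) : ℝ) ≤ Ω)
        (_hw₁' : (NegSup.wInvSup (levWeight (L : ℝ) η lev₁ 2) : ℝ) ≤ Ω),
      ∃ h52 : pdev (perCfg (towerP L m (n + 1)) U) < α₀ * (((L : ℝ) ^ (n + 1))⁻¹) ^ 2,
      ∃ hpos' : ∀ x : SiteL2K ℂ d (towerP L m (n + 1)) c₀ W, x ≠ 0 →
          0 < RCLike.re ⟪x, laplacePrimeAk L m n φ η U a' (c₁ := c₁) x⟫_ℂ,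
      ∃ hposπ : ∀ x : BondL2K ℂ d (towerP L m (n + 1)) c₀ W, x ≠ 0 →
          0 < RCLike.re ⟪x, laplaceAkPi L m n φ τ η U a' hpos' hL (fun j => αT d L α₀ * (((L : ℝ) ^ min (j + 1) (n + 1))⁻¹) ^ 2)
            (fun j => (geomProfile_le_αT (d := d) L (n + 1) hL hα₀.le j).trans (αT_le hL hα4))
            (ulev_mem_U1_of_pdev L m (n + 1) U hL2 (avgClosed_unitaryUnits d L) hUG hα₀ hα3 hα4 h52)
            (ulev_reg_of_pdev_geometric L m (n + 1) U hL2 (avgClosed_unitaryUnits d L) hUG hα₀ hα3 hα4 h52) (c₁ := c₁) a x⟫_ℂ,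
        DifferentiableOn ℂ (chartHB (frakGLatticeCLM (lev₀ := lev₀) φ hposπ
              (QkW_surjective L m n φ U hL _ _ _ _ fun j => le_trans (mul_le_mul_of_nonneg_right (mul_le_mul_of_nonneg_left
                (geomProfile_le_αT (d := d) L (n + 1) hL hα₀.le j) (by positivity)) (by positivity)) hαL) lev₁ (nabla115 η U))
            0 (W80 (rieszτ φ) (LinearMap.toContinuousLinearMap τ) U (H1LatticeCLM (lev₀ := lev₀) (levB := levB) φ hposπ
              (QkW_surjective L m n φ U hL _ _ _ _ fun j => le_trans (mul_le_mul_of_nonneg_right (mul_le_mul_of_nonneg_left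
                (geomProfile_le_αT (d := d) L (n + 1) hL hα₀.le j) (by positivity)) (by positivity)) hαL) lev₁ (nabla115 η U))
              (Cck L m η (n + 1) U lev₀ lev₁ (nabla115 η U) levB) εC (Jcur (L := (L : ℝ)) (η := η) (lev₀ := lev₀) U)
              (currentCLM φ lev₁ (nabla115 η U)
                (laplaceAkPi L m n φ τ η U a' hpos' hL (fun j => αT d L α₀ * (((L : ℝ) ^ min (j + 1) (n + 1))⁻¹) ^ 2)
                    (fun j => (geomProfile_le_αT (d := d) L (n + 1) hL hα₀.le j).trans (αT_le hL hα4))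
                    (ulev_mem_U1_of_pdev L m (n + 1) U hL2 (avgClosed_unitaryUnits d L) hUG hα₀ hα3 hα4 h52)
                    (ulev_reg_of_pdev_geometric L m (n + 1) U hL2 (avgClosed_unitaryUnits d L) hUG hα₀ hα3 hα4 h52) (c₁ := c₁) a
                  - LinearMap.adjoint (QkW L m n φ U hL (fun j => αT d L α₀ * (((L : ℝ) ^ min (j + 1) (n + 1))⁻¹) ^ 2)
                    (fun j => (geomProfile_le_αT (d := d) L (n + 1) hL hα₀.le j).trans (αT_le hL hα4))
                    (ulev_mem_U1_of_pdev L m (n + 1) U hL2 (avgClosed_unitaryUnits d L) hUG hα₀ hα3 hα4 h52)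
                    (ulev_reg_of_pdev_geometric L m (n + 1) U hL2 (avgClosed_unitaryUnits d L) hUG hα₀ hα3 hα4 h52) (c₀ := c₀) (c₁ := c₁)) ∘ₗ
                      ((a : ℂ) • QkW L m n φ U hL (fun j => αT d L α₀ * (((L : ℝ) ^ min (j + 1) (n + 1))⁻¹) ^ 2)
                    (fun j => (geomProfile_le_αT (d := d) L (n + 1) hL hα₀.le j).trans (αT_le hL hα4))
                    (ulev_mem_U1_of_pdev L m (n + 1) U hL2 (avgClosed_unitaryUnits d L) hUG hα₀ hα3 hα4 h52)
                    (ulev_reg_of_pdev_geometric L m (n + 1) U hL2 (avgClosed_unitaryUnits d L) hUG hα₀ hα3 hα4 h52) (c₀ := c₀) (c₁ := c₁))))) 0 (fun A' => A' + solA (H1LatticeCLM (lev₀ := lev₀) (levB := levB) φ hposπ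
              (QkW_surjective L m n φ U hL _ _ _ _ fun j => le_trans (mul_le_mul_of_nonneg_right (mul_le_mul_of_nonneg_left
                (geomProfile_le_αT (d := d) L (n + 1) hL hα₀.le j) (by positivity)) (by positivity)) hαL) lev₁ (nabla115 η U)) 0
              (Cck L m η (n + 1) U lev₀ lev₁ (nabla115 η U) levB) 0 εC A') ε₄
            (H1LatticeCLM (lev₀ := lev₀) (levB := levB) φ hposπ
              (QkW_surjective L m n φ U hL _ _ _ _ fun j => le_trans (mul_le_mul_of_nonneg_right (mul_le_mul_of_nonneg_left
                (geomProfile_le_αT (d := d) L (n + 1) hL hα₀.le j) (by positivity)) (by positivity)) hαL) lev₁ (nabla115 η U)))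
          (ball (0 : NegSize (L : ℝ) η levB 0 𝔸) Rb) ∧
        MapsTo (chartHB (frakGLatticeCLM (lev₀ := lev₀) φ hposπ
              (QkW_surjective L m n φ U hL _ _ _ _ fun j => le_trans (mul_le_mul_of_nonneg_right (mul_le_mul_of_nonneg_left
                (geomProfile_le_αT (d := d) L (n + 1) hL hα₀.le j) (by positivity)) (by positivity)) hαL) lev₁ (nabla115 η U))
            0 (W80 (rieszτ φ) (LinearMap.toContinuousLinearMap τ) U (H1LatticeCLM (lev₀ := lev₀) (levB := levB) φ hposπ
              (QkW_surjective L m n φ U hL _ _ _ _ fun j => le_trans (mul_le_mul_of_nonneg_right (mul_le_mul_of_nonneg_left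
                (geomProfile_le_αT (d := d) L (n + 1) hL hα₀.le j) (by positivity)) (by positivity)) hαL) lev₁ (nabla115 η U))
              (Cck L m η (n + 1) U lev₀ lev₁ (nabla115 η U) levB) εC (Jcur (L := (L : ℝ)) (η := η) (lev₀ := lev₀) U)
              (currentCLM φ lev₁ (nabla115 η U)
                (laplaceAkPi L m n φ τ η U a' hpos' hL (fun j => αT d L α₀ * (((L : ℝ) ^ min (j + 1) (n + 1))⁻¹) ^ 2)
                    (fun j => (geomProfile_le_αT (d := d) L (n + 1) hL hα₀.le j).trans (αT_le hL hα4))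
                    (ulev_mem_U1_of_pdev L m (n + 1) U hL2 (avgClosed_unitaryUnits d L) hUG hα₀ hα3 hα4 h52)
                    (ulev_reg_of_pdev_geometric L m (n + 1) U hL2 (avgClosed_unitaryUnits d L) hUG hα₀ hα3 hα4 h52) (c₁ := c₁) a
                  - LinearMap.adjoint (QkW L m n φ U hL (fun j => αT d L α₀ * (((L : ℝ) ^ min (j + 1) (n + 1))⁻¹) ^ 2)
                    (fun j => (geomProfile_le_αT (d := d) L (n + 1) hL hα₀.le j).trans (αT_le hL hα4))
                    (ulev_mem_U1_of_pdev L m (n + 1) U hL2 (avgClosed_unitaryUnits d L) hUG hα₀ hα3 hα4 h52)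
                    (ulev_reg_of_pdev_geometric L m (n + 1) U hL2 (avgClosed_unitaryUnits d L) hUG hα₀ hα3 hα4 h52) (c₀ := c₀) (c₁ := c₁)) ∘ₗ
                      ((a : ℂ) • QkW L m n φ U hL (fun j => αT d L α₀ * (((L : ℝ) ^ min (j + 1) (n + 1))⁻¹) ^ 2)
                    (fun j => (geomProfile_le_αT (d := d) L (n + 1) hL hα₀.le j).trans (αT_le hL hα4))
                    (ulev_mem_U1_of_pdev L m (n + 1) U hL2 (avgClosed_unitaryUnits d L) hUG hα₀ hα3 hα4 h52)
                    (ulev_reg_of_pdev_geometric L m (n + 1) U hL2 (avgClosed_unitaryUnits d L) hUG hα₀ hα3 hα4 h52) (c₀ := c₀) (c₁ := c₁))))) 0 (fun A' => A' + solA (H1LatticeCLM (lev₀ := lev₀) (levB := levB) φ hposπ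
              (QkW_surjective L m n φ U hL _ _ _ _ fun j => le_trans (mul_le_mul_of_nonneg_right (mul_le_mul_of_nonneg_left
                (geomProfile_le_αT (d := d) L (n + 1) hL hα₀.le j) (by positivity)) (by positivity)) hαL) lev₁ (nabla115 η U)) 0
              (Cck L m η (n + 1) U lev₀ lev₁ (nabla115 η U) levB) 0 εC A') ε₄
            (H1LatticeCLM (lev₀ := lev₀) (levB := levB) φ hposπ
              (QkW_surjective L m n φ U hL _ _ _ _ fun j => le_trans (mul_le_mul_of_nonneg_right (mul_le_mul_of_nonneg_left
                (geomProfile_le_αT (d := d) L (n + 1) hL hα₀.le j) (by positivity)) (by positivity)) hαL) lev₁ (nabla115 η U)))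
          (ball (0 : NegSize (L : ℝ) η levB 0 𝔸) Rb) (ball (0 : Space115 (L : ℝ) η lev₀ lev₁ (nabla115 η U)) R') ∧
        chartHB (frakGLatticeCLM (lev₀ := lev₀) φ hposπ
              (QkW_surjective L m n φ U hL _ _ _ _ fun j => le_trans (mul_le_mul_of_nonneg_right (mul_le_mul_of_nonneg_left
                (geomProfile_le_αT (d := d) L (n + 1) hL hα₀.le j) (by positivity)) (by positivity)) hαL) lev₁ (nabla115 η U))
            0 (W80 (rieszτ φ) (LinearMap.toContinuousLinearMap τ) U (H1LatticeCLM (lev₀ := lev₀) (levB := levB) φ hposπ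
              (QkW_surjective L m n φ U hL _ _ _ _ fun j => le_trans (mul_le_mul_of_nonneg_right (mul_le_mul_of_nonneg_left
                (geomProfile_le_αT (d := d) L (n + 1) hL hα₀.le j) (by positivity)) (by positivity)) hαL) lev₁ (nabla115 η U))
              (Cck L m η (n + 1) U lev₀ lev₁ (nabla115 η U) levB) εC (Jcur (L := (L : ℝ)) (η := η) (lev₀ := lev₀) U)
              (currentCLM φ lev₁ (nabla115 η U)
                (laplaceAkPi L m n φ τ η U a' hpos' hL (fun j => αT d L α₀ * (((L : ℝ) ^ min (j + 1) (n + 1))⁻¹) ^ 2)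
                    (fun j => (geomProfile_le_αT (d := d) L (n + 1) hL hα₀.le j).trans (αT_le hL hα4))
                    (ulev_mem_U1_of_pdev L m (n + 1) U hL2 (avgClosed_unitaryUnits d L) hUG hα₀ hα3 hα4 h52)
                    (ulev_reg_of_pdev_geometric L m (n + 1) U hL2 (avgClosed_unitaryUnits d L) hUG hα₀ hα3 hα4 h52) (c₁ := c₁) a
                  - LinearMap.adjoint (QkW L m n φ U hL (fun j => αT d L α₀ * (((L : ℝ) ^ min (j + 1) (n + 1))⁻¹) ^ 2)
                    (fun j => (geomProfile_le_αT (d := d) L (n + 1) hL hα₀.le j).trans (αT_le hL hα4))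
                    (ulev_mem_U1_of_pdev L m (n + 1) U hL2 (avgClosed_unitaryUnits d L) hUG hα₀ hα3 hα4 h52)
                    (ulev_reg_of_pdev_geometric L m (n + 1) U hL2 (avgClosed_unitaryUnits d L) hUG hα₀ hα3 hα4 h52) (c₀ := c₀) (c₁ := c₁)) ∘ₗ
                      ((a : ℂ) • QkW L m n φ U hL (fun j => αT d L α₀ * (((L : ℝ) ^ min (j + 1) (n + 1))⁻¹) ^ 2)
                    (fun j => (geomProfile_le_αT (d := d) L (n + 1) hL hα₀.le j).trans (αT_le hL hα4))
                    (ulev_mem_U1_of_pdev L m (n + 1) U hL2 (avgClosed_unitaryUnits d L) hUG hα₀ hα3 hα4 h52)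
                    (ulev_reg_of_pdev_geometric L m (n + 1) U hL2 (avgClosed_unitaryUnits d L) hUG hα₀ hα3 hα4 h52) (c₀ := c₀) (c₁ := c₁))))) 0 (fun A' => A' + solA (H1LatticeCLM (lev₀ := lev₀) (levB := levB) φ hposπ
              (QkW_surjective L m n φ U hL _ _ _ _ fun j => le_trans (mul_le_mul_of_nonneg_right (mul_le_mul_of_nonneg_left
                (geomProfile_le_αT (d := d) L (n + 1) hL hα₀.le j) (by positivity)) (by positivity)) hαL) lev₁ (nabla115 η U)) 0
              (Cck L m η (n + 1) U lev₀ lev₁ (nabla115 η U) levB) 0 εC A') ε₄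
            (H1LatticeCLM (lev₀ := lev₀) (levB := levB) φ hposπ
              (QkW_surjective L m n φ U hL _ _ _ _ fun j => le_trans (mul_le_mul_of_nonneg_right (mul_le_mul_of_nonneg_left
                (geomProfile_le_αT (d := d) L (n + 1) hL hα₀.le j) (by positivity)) (by positivity)) hαL) lev₁ (nabla115 η U)) 0 = 0 := by
  classical
  have hω : 0 ≤ ω := zero_le_one.trans hω1
  have hΩ : 0 ≤ Ω := zero_le_one.trans hΩ1
  -- the lattice-free V₀-letter `C_V` at `‖ρ‖ ≤ M_φ²`, `‖τ‖ ≤ 1`, `α ≤ α₀`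
  obtain ⟨CV, hCVdef⟩ : ∃ CV : ℝ, CV = 1024 * ((d - 1 : ℕ) : ℝ) * (ω * Ω) ^ 3 * (Mφ * Mφ) * (α₀ * 1 * ω ^ 2 + 1 / 16)
      + ((d - 1 : ℕ) : ℝ) * (ω * Ω) ^ 3 * (136 + 2 * (ω * Ω)) * (Mφ * Mφ) * 1 := ⟨_, rfl⟩
  have hCV : 0 ≤ CV := by rw [hCVdef]; positivity
  obtain ⟨α₁, j₁, ε₄, εC, Rb, R', hα₁, hj₁, hRb0, hR'0, H⟩ :=
    cur_chart_exists_tower_pi_of_unitary_class_lattice_uniform_W80Delta hd L hL hL2 hL3 φ hMφ hMφ' hφ hφ' ha ha' τ hτ hCτ hτm hMτ hρw hτ₁ hτ₂ hφτ hα₀ hα3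
      hα4 hαL hρ0 hρ hρ4 hθ hC3 hω hΩ (CV := CV) (RV := 1 / 16) (Mr := Mφ * Mφ) (MJ := ω ^ 3) hCV (by norm_num) (mul_nonneg hMφ hMφ) (by positivity)
  refine ⟨min α₁ α₀, min j₁ 1, ε₄, εC, Rb, R', lt_min hα₁ hα₀, lt_min hj₁ one_pos, hRb0, hR'0, ?_⟩
  intro n η _ hηL c₀ c₁ _ _ hw hc₀η hρ' m _ hm U hUG α hα0 hαle hUη hpl hUgrad j₀ hJ hj' lev₀ lev₁ levB hlev hw₀ hw₁ hw₃ hwB hw₁'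
  have hη0 : 0 < η := Fact.out
  have hL1 : (1 : ℝ) ≤ (L : ℝ) := by exact_mod_cast hL
  have hαle₁ : α ≤ α₁ := hαle.trans (min_le_left _ _)
  have hαle₀ : α ≤ α₀ := hαle.trans (min_le_right _ _)
  have hj₁' : j₀ ≤ j₁ := hj'.trans (min_le_left _ _)
  have hj1 : j₀ ≤ 1 := hj'.trans (min_le_right _ _)
  -- the class: `U(b)` unitary, `U(b)⋆ = U(b)⁻¹`, `U(b) ∈ U1`
  have hUS : ∀ b, U b ∈ unitaryUnits 𝔸 := fun b => by
    have h := hUG (liftSite b.1) b.2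
    rwa [B9Eq315QTorus.perCfg_apply, perSite_liftSite] at h
  have hUst : ∀ b, star (U b : 𝔸) = (((U b)⁻¹ : 𝔸ˣ) : 𝔸) := forall_star_eq_inv_of_mem hUS
  have hUb : ∀ b, U b ∈ U1 𝔸 := fun b => unitaryUnits_le_U1 (hUS b)
  -- the trace as a continuous functional: tracial, ⋆-compatible, contractive (for the V₀-letter)
  have hτc2 : ∀ a b : 𝔸, LinearMap.toContinuousLinearMap τ (a * b) = LinearMap.toContinuousLinearMap τ (b * a) := fun a b => hτ₂ a b
  have hτcs : ∀ a : 𝔸, LinearMap.toContinuousLinearMap τ (star a) = starRingEnd ℂ (LinearMap.toContinuousLinearMap τ a) := fun a => hτ₁ a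
  have hτc1 : ∀ X : 𝔸, ‖LinearMap.toContinuousLinearMap τ X‖ ≤ ‖X‖ := fun X =>
    (hτ X).trans (mul_le_of_le_one_left (norm_nonneg X) hCτ1)
  -- `‖rieszτ φ‖ ≤ M_φ²`
  have hρn : ‖rieszτ (𝔸 := 𝔸) φ‖ ≤ Mφ * Mφ := by
    refine ContinuousLinearMap.opNorm_le_bound _ (mul_nonneg hMφ hMφ) fun ℓ => ?_
    have hφL : ‖(haveI : FiniteDimensional ℂ 𝔸 := LinearEquiv.finiteDimensional φ;
        LinearMap.toContinuousLinearMap φ.toLinearMap)‖ ≤ Mφ :=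
      ContinuousLinearMap.opNorm_le_bound _ hMφ fun w => by simpa using hφ w
    rw [rieszτ_apply, norm_star]
    calc ‖φ ((InnerProductSpace.toDual ℂ W).symm (ℓ.comp (haveI : FiniteDimensional ℂ 𝔸 := LinearEquiv.finiteDimensional φ;
            LinearMap.toContinuousLinearMap φ.toLinearMap)))‖
        ≤ Mφ * ‖(InnerProductSpace.toDual ℂ W).symm (ℓ.comp (haveI : FiniteDimensional ℂ 𝔸 := LinearEquiv.finiteDimensional φ;
            LinearMap.toContinuousLinearMap φ.toLinearMap))‖ := hφ _
      _ = Mφ * ‖ℓ.comp (haveI : FiniteDimensional ℂ 𝔸 := LinearEquiv.finiteDimensional φ;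
            LinearMap.toContinuousLinearMap φ.toLinearMap)‖ := by rw [LinearIsometryEquiv.norm_map]
      _ ≤ Mφ * (‖ℓ‖ * ‖(haveI : FiniteDimensional ℂ 𝔸 := LinearEquiv.finiteDimensional φ;
            LinearMap.toContinuousLinearMap φ.toLinearMap)‖) := by
          gcongr; exact ContinuousLinearMap.opNorm_comp_le _ _
      _ ≤ Mφ * (‖ℓ‖ * Mφ) := by gcongr
      _ = Mφ * Mφ * ‖ℓ‖ := by ring
  -- the profile letter `w̲₀⁻¹ ≤ 1 ≤ Ω` from `j(b) ≥ n+1`, `L^{n+1}η = 1`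
  have hΩ₀ : (NegSup.wInvSup (levWeight (L : ℝ) η lev₀ 1) : ℝ) ≤ Ω := by
    have h : NegSup.wInvSup (levWeight (L : ℝ) η lev₀ 1) ≤ 1 :=
      Finset.sup_le fun b _ => by
        refine inv_le_one_of_one_le₀ ?_
        rw [← NNReal.coe_le_coe, NegSup.coe_wNN (w := levWeight (L : ℝ) η lev₀ 1), levWeight_apply, pow_one, NNReal.coe_one]
        calc (1 : ℝ) = (L : ℝ) ^ (n + 1) * η := by rw [mul_comm]; exact hηL.symm
          _ ≤ (L : ℝ) ^ lev₀ b * η := mul_le_mul_of_nonneg_right (pow_le_pow_right₀ hL1 (hlev b)) hη0.le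
    have h' : ((NegSup.wInvSup (levWeight (L : ℝ) η lev₀ 1) : NNReal) : ℝ) ≤ 1 := by exact_mod_cast h
    exact h'.trans hΩ1
  have hτn : ‖LinearMap.toContinuousLinearMap τ‖ ≤ 1 :=
    ContinuousLinearMap.opNorm_le_bound _ zero_le_one fun X => by simpa only [one_mul] using hτc1 X
  -- the V₀-group's (98)-letter, SUPPLIED (lattice-free `C_V`, `R_V = 1/16`; the letters `‖ρ‖ ≤ M_φ²`, `‖τ‖ ≤ 1`)
  have hqV : ∀ Y : Space115 (L : ℝ) η lev₀ lev₁ (nabla115 η U), ‖Y‖ < 1 / 16 →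
      ‖curV0 (lev₁ := lev₁) (Dc := nabla115 η U) (rieszτ φ) (LinearMap.toContinuousLinearMap τ) U Y‖ ≤ CV * ‖Y‖ ^ 2 := by
    intro Y hY
    refine (curV0_quadBound_lattice_uniform (L := (L : ℝ)) (η := η) (lev₀ := lev₀) (lev₁ := lev₁) (rieszτ φ)
      (LinearMap.toContinuousLinearMap τ) hτc2 hτcs hτc1 hL1 hUb hUst hα0 hpl hω1 hΩ1 hw₀ hΩ₀ hw₁' Y hY).trans ?_
    rw [hCVdef]
    have hω0 : 0 < ω := by linarith
    have hΩ0 : 0 < Ω := by linarith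
    gcongr
  -- the current letter `M_J := ω³` from the window `j₀ ≤ j₁ ≤ 1`
  have hJn : ‖Jcur (L := (L : ℝ)) (η := η) (lev₀ := lev₀) U‖ ≤ ω ^ 3 := by
    have hj0 : (0 : ℝ) ≤ max j₀ 0 := le_max_right _ _
    have hJ' : ∀ μ y, ‖B9Eq39Adjoint.J (fun μ => B9Eq33CovDerivVector.shiftEquiv μ) (fun μ y => U (y, μ)) η μ y‖ ≤ max j₀ 0 :=
      fun μ y => (hJ μ y).trans (le_max_left _ _)
    have hwb : ∀ b, levWeight (L : ℝ) η lev₀ 1 b ≤ ω := fun b => (NegSup.le_wSup (w := levWeight (L : ℝ) η lev₀ 1) b).trans hw₀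
    have h := norm_Jcur_le_of_window (𝔸 := 𝔸) (L : ℝ) U hj0 (by positivity) (levWeight_three_le (L : ℝ) hwb) hJ'
    refine h.trans ?_
    have h1 : max j₀ 0 ≤ 1 := max_le hj1 zero_le_one
    calc ω ^ 3 * max j₀ 0 ≤ ω ^ 3 * 1 := by gcongr
      _ = ω ^ 3 := mul_one _
  exact H n η hηL c₀ c₁ hw hc₀η hρ' m hm U hUG α hα0 hαle₁ hUη hpl hUgrad j₀ hJ hj₁' lev₀ lev₁ levB hlev hw₀ hw₁ hw₃ hwB
    (rieszτ φ) hρn hqV (Jcur (L := (L : ℝ)) (η := η) (lev₀ := lev₀) U) hJn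

end Summit.QuantumFields.BalabanUV.T4Continuum.NE9CurChartTowerPiLatticeUniformClassW80VJDelta
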